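import Mathlib
import Summits.Langlands.Langlands.Theorems.CapacityClassicalityEigenIntegralOverconvergentIsClassicalNormLowerBound

/-! # Route CapacityClassicality — the Liouville squeeze on a ghost tower
(stub for crux stmt-Langlands-8927, line Sketch)

Let `E` be a number field, `p` a prime and `λ : ℕ → 𝓞 E` a sequence of algebraic integers such
that

* (`p`-adic side) `p ^ (m j) ∣ λ j` in `𝓞 E` with `m j ≥ c • p ^ j` for a fixed `c > 0`;
* (archimedean side) for every complex embedding `σ : E →+* ℂ` and every `ε > 0` there is a
  constant `C` with `‖σ (λ j)‖ ≤ C · exp (ε p ^ j)` for all `j`.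

Then `λ j = 0` for all large `j`.

Proof.  `E` has finitely many complex embeddings.  Put `L := log p > 0`, `ε := c L / 2 > 0`, pick
`C_σ` for each `σ` from the archimedean hypothesis and let `C := ∑_σ |C_σ|`, a uniform constant.
Since `exp (ε p ^ j) → ∞`, there is `J` with `C < exp (ε p ^ j)` for `j ≥ J`.  If `j ≥ J` and
`λ j ≠ 0`, the Liouville lower bound `exists_embedding_norm_ge_of_prime_pow_dvd` gives an
embedding `σ` with `p ^ (m j) ≤ ‖σ (λ j)‖ ≤ C exp (ε p ^ j) < exp (ε p ^ j) ^ 2 = exp (c p ^ j L)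
≤ exp (m j · L) = p ^ (m j)`, a contradiction.
-/

set_option linter.dupNamespace false -- `Summit.Langlands.Langlands` is the mandated namespace

open NumberField

namespace Summit.Langlands.Langlands.Theorems.CapacityClassicality

/-- **Liouville squeeze.**  A sequence `λ : ℕ → 𝓞 E` of algebraic integers of a number field `E`
which is `p`-adically divisible by `p ^ (m j)` with `m j ≥ c p ^ j` (`c > 0`) and whose complex
conjugates grow sub-exponentially in `p ^ j` at every embedding (`‖σ (λ j)‖ ≤ C_{σ,ε} e^{ε p^j}`
for every `ε > 0`) vanishes for all large `j`: otherwise some conjugate has absolute value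
`≥ p ^ (m j) ≥ e^{c log p · p^j}`, which beats `C e^{ε p^j}` for `ε = c log p / 2` and `j ≫ 0`.
[folklore] -/
theorem liouville_squeeze (E : Type) [Field E] [NumberField E] (p : ℕ) (hp : p.Prime)
    (lam : ℕ → 𝓞 E) (c : ℝ) (hc : 0 < c) (m : ℕ → ℕ) (hm : ∀ j : ℕ, c * (p : ℝ) ^ j ≤ m j)
    (hdiv : ∀ j : ℕ, ((p : 𝓞 E) ^ (m j)) ∣ lam j)
    (hrad : ∀ (σ : E →+* ℂ) (ε : ℝ), 0 < ε → ∃ C : ℝ, ∀ j : ℕ,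
      ‖σ (lam j : E)‖ ≤ C * Real.exp (ε * (p : ℝ) ^ j)) :
    ∃ J : ℕ, ∀ j : ℕ, J ≤ j → lam j = 0 := by
  have hp1 : (1 : ℝ) < p := by exact_mod_cast hp.one_lt
  have hp0 : (0 : ℝ) < p := lt_trans one_pos hp1
  have hL : 0 < Real.log p := Real.log_pos hp1
  -- the exponent `ε := c log p / 2`
  have hε : 0 < c * Real.log p / 2 := by positivity
  -- a uniform archimedean constant over the finitely many complex embeddings
  choose Cf hCf using fun σ : E →+* ℂ => hrad σ (c * Real.log p / 2) hε
  have hCfC : ∀ σ : E →+* ℂ, Cf σ ≤ ∑ τ : E →+* ℂ, |Cf τ| := fun σ =>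
    (le_abs_self _).trans
      (Finset.single_le_sum (f := fun τ => |Cf τ|) (fun τ _ => abs_nonneg _) (Finset.mem_univ σ))
  -- `exp (ε p ^ j) → ∞`, so it eventually exceeds the uniform constant
  have htend : Filter.Tendsto (fun j : ℕ => Real.exp (c * Real.log p / 2 * (p : ℝ) ^ j))
      Filter.atTop Filter.atTop :=
    Real.tendsto_exp_atTop.comp ((tendsto_pow_atTop_atTop_of_one_lt hp1).const_mul_atTop hε)
  obtain ⟨J, hJ⟩ :=
    Filter.eventually_atTop.mp (htend.eventually_gt_atTop (∑ τ : E →+* ℂ, |Cf τ|))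
  refine ⟨J, fun j hj => ?_⟩
  by_contra hne
  -- Liouville lower bound at some embedding
  obtain ⟨σ, hσ⟩ :=
    exists_embedding_norm_ge_of_prime_pow_dvd E p hp (m j) (lam j) hne (hdiv j)
  have hexp_pos : 0 < Real.exp (c * Real.log p / 2 * (p : ℝ) ^ j) := Real.exp_pos _
  -- archimedean upper bound with the uniform constant
  have hub : ‖σ (lam j : E)‖ ≤
      (∑ τ : E →+* ℂ, |Cf τ|) * Real.exp (c * Real.log p / 2 * (p : ℝ) ^ j) :=
    (hCf σ j).trans (mul_le_mul_of_nonneg_right (hCfC σ) hexp_pos.le)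
  -- `p ^ (m j) = exp (m j log p) ≥ exp (c p ^ j log p) = exp (ε p ^ j) ^ 2`
  have hlb : Real.exp (c * Real.log p / 2 * (p : ℝ) ^ j) *
      Real.exp (c * Real.log p / 2 * (p : ℝ) ^ j) ≤ (p : ℝ) ^ (m j) := by
    have hpow : (p : ℝ) ^ (m j) = Real.exp ((m j : ℝ) * Real.log p) := by
      rw [Real.exp_nat_mul, Real.exp_log hp0]
    rw [← Real.exp_add, hpow, Real.exp_le_exp]
    have h2 : c * Real.log p / 2 * (p : ℝ) ^ j + c * Real.log p / 2 * (p : ℝ) ^ j =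
        c * (p : ℝ) ^ j * Real.log p := by ring
    rw [h2]
    exact mul_le_mul_of_nonneg_right (hm j) hL.le
  -- squeeze
  have hlt : (∑ τ : E →+* ℂ, |Cf τ|) * Real.exp (c * Real.log p / 2 * (p : ℝ) ^ j) <
      Real.exp (c * Real.log p / 2 * (p : ℝ) ^ j) *
        Real.exp (c * Real.log p / 2 * (p : ℝ) ^ j) :=
    mul_lt_mul_of_pos_right (hJ j hj) hexp_pos
  linarith

/-- **Liouville squeeze**, under the name registered for the stub of line `Sketch`
(crux `stmt-Langlands-8927`): verbatim restatement of `liouville_squeeze`. [folklore] -/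
theorem stub_liouville_squeeze (E : Type) [Field E] [NumberField E] (p : ℕ) (hp : p.Prime)
    (lam : ℕ → 𝓞 E) (c : ℝ) (hc : 0 < c) (m : ℕ → ℕ) (hm : ∀ j : ℕ, c * (p : ℝ) ^ j ≤ m j)
    (hdiv : ∀ j : ℕ, ((p : 𝓞 E) ^ (m j)) ∣ lam j)
    (hrad : ∀ (σ : E →+* ℂ) (ε : ℝ), 0 < ε → ∃ C : ℝ, ∀ j : ℕ,
      ‖σ (lam j : E)‖ ≤ C * Real.exp (ε * (p : ℝ) ^ j)) :
    ∃ J : ℕ, ∀ j : ℕ, J ≤ j → lam j = 0 :=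
  liouville_squeeze E p hp lam c hc m hm hdiv hrad

end Summit.Langlands.Langlands.Theorems.CapacityClassicality
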